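import Literature.IUT.LogVolume.TensorPacketDifferentSharp
import HarnessLib

/-!
# The SHARP lower end of the (Ind2)-orbit-hull volume: `log‖g‖ + (d_I − d_{L_J})·log p ≤ log μ̄(hull(⋃γ·M))`
# (Dupuy–Hilado §4.9–4.12; [IUTchIV] Prop. 1.1 read backwards, Prop. 1.2 (i))

abc-iut cell, seat abc-iut-w6-d018 (R2 TARGET #1 «Rest_lower», part 2 of 2). Sequel to abc-iut-w5-d180/w5-d082's
`TensorPacketContentBounds`/`TensorPacketContentVolume` and to `TensorPacketDifferentSharp` (part 1). For a bounded
region `M ⊄ {0}` of `V = ⊗_{ℚ_p} k_i` of content `m` w.r.t. `Λ := log_p(R_I^×)` one has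
`log μ̄(hull(⋃_{γ∈Ind2} γ·M)) = −m·log p + H`, `H := log μ̄(hull(Λ))` (w5-d180, exact); w5-d082 bounded `m` above
through volumes (`content_mul_log_le_of_smul_subset`), which sees the index of `R_I` in `(R_I)^∼` only in part.
HERE the sharp converse of Prop. 1.1 cashes that index in exactly:
* `exists_mem_integerPacket_of_mem_logPacket_of_dominates` — `Λ ⊆ (⊗c_i)·R_I` for any `c_i ∈ k_i^×` dominating
  the `log_p(R_i^×)` ([IUTchIV] p. 11, fourth inclusion, with `p^{−b_i}` replaced by `c_i`);
* **`content_mul_log_le_sharp`** — `ι_i(g)·(R_I)^∼ ⊆ p^m·Λ` forces, for every factor `L_J`,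
  `m·log p ≤ −log‖g‖ + Σ_i log‖c_i‖ − (d_I − d_{L_J})·log p` (with `c_i = p^{−b_i}`:
  `TensorPacketContentBounds.content_le_of_iota_mem` sharpened by exactly `(d_I − d_{L_J})·log p`);
* `purePacket_smul_normalizedPacket_subset_packetHull_logPacket`, `sum_log_norm_le_packetLogμ_packetHull_logPacket`
  — for `c_i ∈ log_p(R_i^×)`: `(⊗c_i)·(R_I)^∼ ⊆ hull(Λ)`, so `Σ log‖c_i‖ ≤ H`;
* **`packetLogμ_packetHull_orbit_ge_sharp`** (`_of_dominates`, `_inf`) — for bounded `M ⊇ ι_i(g)·(R_I)^∼`,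
  `g ≠ 0`, and EVERY `J`: **`log‖g‖ + (d_I − d_{L_J})·log p ≤ log μ̄(hull(⋃_{γ∈Ind2} γ·M))`** (choose `c_i` of
  largest norm in `log_p(R_i^×)`; the `c`'s cancel). Against the Step (v) upper end
  `δ_Λ + {−λ_min + d_I + 1 + 4|I*|/p}·log p` (`packetLogμ_packetHull_orbit_le_first`) the undecided band at a
  summand is `{min_J d_{L_J} + 1 + 4|I*|/p}·log p + δ_Λ` instead of `{d_I + …}·log p` (for `j+1` copies of one
  Galois `k/ℚ_p`: `L_J ≅ k`, recovered `j·d` of `d_I = (j+1)·d`).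
[cite: DupuyHilado2025, §4.9, §4.12] [cite: Mochizuki2012, IUTchIV Prop. 1.1 p. 9, Prop. 1.2 (i) p. 10–11]
HONEST SCOPE: summand level; (Ind2)/the hull are the tree's typings of the disputed corpus [claim: Mochizuki2012,
status: disputed]; no side taken on [IUTchIII] Cor. 3.12; `d_{L_J}` is left as a term. PROOF-ONLY file: no
definitions, no named `Prop` facts.
-/

noncomputable section

open Set Module Function
open scoped Pointwise TensorProduct NormedField nonZeroDivisors

namespace Literature.IUT.LogVolume

section Packet

variable (p : ℕ) [Fact p.Prime]
variable {I : Type} [Fintype I] [DecidableEq I] [Nonempty I]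
variable (k : I → Type) [∀ i, NontriviallyNormedField (k i)] [∀ i, NormedAlgebra ℚ_[p] (k i)]
  [∀ i, IsUltrametricDist (k i)] [∀ i, ProperSpace (k i)]

/-! ## The sharp upper bound on the content and lower bound on the orbit-hull volume -/

omit [Fintype I] [DecidableEq I] [Nonempty I] [∀ i, IsUltrametricDist (k i)] [∀ i, ProperSpace (k i)] in
/-- `log_p(R_I^×) ⊆ (⊗c_i)·R_I` for any family `c_i ∈ k_i^×` dominating the `log_p(R_i^×)` (every
`z ∈ log_p(R_i^×)` has `‖z‖ ≤ ‖c_i‖`): on pure tensors `⊗z_i = (⊗c_i)·⊗(z_i/c_i)` with `‖z_i/c_i‖ ≤ 1`.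
(With `c_i = p^{−b_i}` this is [IUTchIV] p. 11, fourth inclusion.) [cite: Mochizuki2012, IUTchIV Prop. 1.2 (i) p. 10] -/
theorem exists_mem_integerPacket_of_mem_logPacket_of_dominates {c : Π i, k i} (hc0 : ∀ i, c i ≠ 0)
    (hc : ∀ i, ∀ z ∈ logUnits (k i), ‖z‖ ≤ ‖c i‖) {w : PacketAlgebra p k} (hw : w ∈ logPacket p k) :
    ∃ a ∈ integerPacket p k, w = purePacket p k c * a := by
  induction hw using AddSubgroup.closure_induction with
  | mem t ht =>
    obtain ⟨z, hz, rfl⟩ := ht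
    refine ⟨purePacket p k (fun i => z i / c i), purePacket_mem_integerPacket p k fun i => ?_, ?_⟩
    · rw [norm_div, div_le_one (norm_pos_iff.mpr (hc0 i))]
      exact hc i (z i) (hz i)
    · rw [purePacket_mul]
      congr 1
      funext i
      rw [Pi.mul_apply, mul_div_cancel₀ _ (hc0 i)]
  | zero => exact ⟨0, zero_mem _, by rw [mul_zero]⟩
  | add a b _ _ ha hb =>
    obtain ⟨a', ha', rfl⟩ := ha
    obtain ⟨b', hb', rfl⟩ := hb
    exact ⟨a' + b', add_mem ha' hb', by rw [mul_add]⟩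
  | neg a _ ha =>
    obtain ⟨a', ha', rfl⟩ := ha
    exact ⟨-a', neg_mem ha', by rw [mul_neg]⟩

/-- **SHARP CONTENT BOUND.** For a dominating family `c` as above (`c_i ≠ 0`), `g ∈ k_i^×` and `m ∈ ℤ`: if the
bare region `ι_i(g)·(R_I)^∼` lies in `p^m·log_p(R_I^×)`, then for every factor `L_J`
`m·log p ≤ −log‖g‖ + Σ_i log‖c_i‖ − (d_I − d_{L_J})·log p`. (Take `u := p^{−m}·(⊗c_i)⁻¹·ι_i(g)`: then
`u·(R_I)^∼ ⊆ R_I`, and `‖ψ_J(u)‖ = p^m·‖g‖/∏‖c_i‖`.) With `c_i = p^{−b_i}` this sharpens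
`TensorPacketContentBounds.content_le_of_iota_mem` by exactly `(d_I − d_{L_J})·log p`.
[cite: Mochizuki2012, IUTchIV Prop. 1.1 p. 9, Prop. 1.2 (i) p. 10] -/
theorem content_mul_log_le_sharp {c : Π i, k i} (hc0 : ∀ i, c i ≠ 0)
    (hc : ∀ i, ∀ z ∈ logUnits (k i), ‖z‖ ≤ ‖c i‖) {i : I} {g : k i} (hg0 : g ≠ 0) {m : ℤ}
    (h : iota p k i g • (normalizedPacket p k : Set (PacketAlgebra p k)) ⊆
      ((p : ℚ_[p]) ^ m) • (logPacket p k : Set (PacketAlgebra p k))) (J : DIdx p k) :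
    (m : ℝ) * Real.log p ≤ -Real.log ‖g‖ + ∑ i, Real.log ‖c i‖
      - (dSum p k - differentOrd p (DFac p k J)) * Real.log p := by
  have hp : p.Prime := Fact.out
  have hp1 : (1 : ℝ) < p := by exact_mod_cast hp.one_lt
  have hp0 : (0 : ℝ) < p := by linarith
  -- `u := p^{−m} · ⊗c⁻¹ · ι_i(g)`
  set u : PacketAlgebra p k := ppow p k (-m) * purePacket p k (fun i => (c i)⁻¹) * iota p k i g with hudef
  have hcinv : purePacket p k (fun i => (c i)⁻¹) * purePacket p k c = 1 := by
    rw [purePacket_mul]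
    have : ((fun i => (c i)⁻¹) * c) = 1 := funext fun i => by
      rw [Pi.mul_apply, Pi.one_apply, inv_mul_cancel₀ (hc0 i)]
    rw [this]
    exact (PiTensorProduct.tprodMonoidHom ℚ_[p]).map_one
  have hpinv : ppow p k (-m) * ppow p k m = 1 := by
    rw [ppow, ppow, ← map_mul, ← zpow_add₀ (Nat.cast_ne_zero.mpr hp.ne_zero), neg_add_cancel, zpow_zero,
      map_one]
  -- `u·(R_I)^∼ ⊆ R_I`
  have hu : u • (normalizedPacket p k : Set (PacketAlgebra p k)) ⊆
      (integerPacket p k : Set (PacketAlgebra p k)) := by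
    rintro _ ⟨x, hx, rfl⟩
    have hgx : iota p k i g * x ∈ ((p : ℚ_[p]) ^ m) • (logPacket p k : Set (PacketAlgebra p k)) :=
      h (Set.smul_mem_smul_set hx)
    rw [← ppow_smul_set_eq] at hgx
    obtain ⟨w, hw, hgxw⟩ := Set.mem_smul_set.mp hgx
    obtain ⟨a, ha, rfl⟩ := exists_mem_integerPacket_of_mem_logPacket_of_dominates p k hc0 hc hw
    rw [smul_eq_mul] at hgxw
    have : u • x = a := by
      rw [smul_eq_mul, hudef, mul_assoc, mul_assoc, ← hgxw]
      calc ppow p k (-m) * (purePacket p k (fun i => (c i)⁻¹) * (ppow p k m * (purePacket p k c * a)))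
          = (ppow p k (-m) * ppow p k m) * (purePacket p k (fun i => (c i)⁻¹) * purePacket p k c) * a := by
            ring
        _ = a := by rw [hpinv, hcinv, one_mul, one_mul]
    show u • x ∈ (integerPacket p k : Set (PacketAlgebra p k))
    rw [this]
    exact ha
  have hcore := norm_dEquiv_le_of_smul_normalizedPacket_subset p k hu J
  -- `‖ψ_J(u)‖ = p^m · (∏‖c_i‖)⁻¹ · ‖g‖`
  have hnorm : ‖dEquiv p k u J‖ = (p : ℝ) ^ (m : ℝ) * (∏ i, ‖c i‖)⁻¹ * ‖g‖ := by
    rw [hudef, map_mul, map_mul, Pi.mul_apply, Pi.mul_apply, norm_mul, norm_mul,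
      norm_psi_ppow_apply p k (DFac p k) (dEquiv p k), norm_dEquiv_iota, psi_purePacket_apply, norm_prod]
    simp_rw [norm_factorEmb, norm_inv, Finset.prod_inv_distrib]
    rw [neg_neg, ← Real.rpow_intCast]
  rw [hnorm] at hcore
  -- take logarithms
  have hprod : 0 < ∏ i, ‖c i‖ := Finset.prod_pos fun i _ => norm_pos_iff.mpr (hc0 i)
  have hg : 0 < ‖g‖ := norm_pos_iff.mpr hg0
  have hlhs : 0 < (p : ℝ) ^ (m : ℝ) * (∏ i, ‖c i‖)⁻¹ * ‖g‖ := by positivity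
  have hlog := Real.log_le_log hlhs hcore
  rw [Real.log_mul (by positivity) hg.ne', Real.log_mul (by positivity) (inv_pos.mpr hprod).ne',
    Real.log_inv, Real.log_rpow hp0, Real.log_rpow hp0,
    Real.log_prod (fun i _ => (norm_pos_iff.mpr (hc0 i)).ne')] at hlog
  linarith

omit [Fintype I] [DecidableEq I] [Nonempty I] [∀ i, IsUltrametricDist (k i)] [∀ i, ProperSpace (k i)] in
/-- `(⊗c_i)·(R_I)^∼ ⊆ hull(log_p(R_I^×))` for `c_i ∈ log_p(R_i^×)`: the hull is an `(R_I)^∼`-module containing the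
pure tensor `⊗c_i ∈ log_p(R_I^×)`. [cite: DupuyHilado2025, Rmk. 4.12.1] -/
theorem purePacket_smul_normalizedPacket_subset_packetHull_logPacket {c : Π i, k i}
    (hcΛ : ∀ i, c i ∈ logUnits (k i)) :
    purePacket p k c • (normalizedPacket p k : Set (PacketAlgebra p k)) ⊆
      packetHull p k (logPacket p k : Set (PacketAlgebra p k)) := by
  rintro _ ⟨x, hx, rfl⟩
  show purePacket p k c • x ∈ packetHull p k (logPacket p k : Set (PacketAlgebra p k))
  rw [packetHull_apply, SetLike.mem_coe, smul_eq_mul, mul_comm]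
  have hmem : purePacket p k c ∈ packetSpan p k (logPacket p k : Set (PacketAlgebra p k)) :=
    Submodule.subset_span (AddSubgroup.subset_closure ⟨c, hcΛ, rfl⟩)
  exact (packetSpan p k (logPacket p k : Set (PacketAlgebra p k))).smul_mem ⟨x, hx⟩ hmem

/-- `Σ_i log‖c_i‖ ≤ log μ̄(hull(log_p(R_I^×)))` for `c_i ∈ log_p(R_i^×)`, `c_i ≠ 0` (monotonicity of `log μ̄` and
`log μ̄((⊗c_i)·(R_I)^∼) = Σ log‖c_i‖`). [cite: DupuyHilado2025, §3.7, §4.12] -/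
theorem sum_log_norm_le_packetLogμ_packetHull_logPacket {c : Π i, k i} (hc0 : ∀ i, c i ≠ 0)
    (hcΛ : ∀ i, c i ∈ logUnits (k i)) :
    ∑ i, Real.log ‖c i‖ ≤ packetLogμ p k (packetHull p k (logPacket p k : Set (PacketAlgebra p k))) := by
  have hadm := packetAdm_smul p k (purePacket p k c) (dEquiv_purePacket_ne_zero p k hc0)
    (packetAdm_normalizedPacket p k)
  have hmono := packetLogμ_mono p k hadm (packetAdm_packetHull_logPacket p k)
    (purePacket_smul_normalizedPacket_subset_packetHull_logPacket p k hcΛ)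
  have hvol : packetLogμ p k (purePacket p k c • (normalizedPacket p k : Set (PacketAlgebra p k))) =
      ∑ i, Real.log ‖c i‖ := by
    have h0 := packetLogVolume_ppow_mul_purePacket_smul p k (DFac p k) (dEquiv p k) 0 c hc0
    have h1 : ppow p k 0 = 1 := by rw [ppow, zpow_zero, map_one]
    rw [h1, one_mul, Int.cast_zero, zero_mul, neg_zero, zero_add] at h0
    exact h0
  rw [← hvol]
  exact hmono

/-- **SHARP LOWER END OF THE ORBIT-HULL VOLUME, with a chosen dominating family.** For `c_i ∈ log_p(R_i^×)`
dominating `log_p(R_i^×)`, a bounded region `M ⊇ ι_i(g)·(R_I)^∼` (`g ≠ 0`) and every factor `L_J`: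
`log‖g‖ + (d_I − d_{L_J})·log p ≤ log μ̄(hull(⋃_{γ∈Ind2} γ·M))` (content formula
`log μ̄ = −m·log p + H`, the sharp content bound, and `Σ log‖c_i‖ ≤ H`). [cite: DupuyHilado2025, §4.9, §4.12] -/
theorem packetLogμ_packetHull_orbit_ge_sharp_of_dominates {c : Π i, k i} (hc0 : ∀ i, c i ≠ 0)
    (hc : ∀ i, ∀ z ∈ logUnits (k i), ‖z‖ ≤ ‖c i‖) (hcΛ : ∀ i, c i ∈ logUnits (k i))
    {M : Set (PacketAlgebra p k)} (hMb : IsPsiBounded p k M) {i : I} {g : k i} (hg0 : g ≠ 0)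
    (hgM : iota p k i g • (normalizedPacket p k : Set (PacketAlgebra p k)) ⊆ M) (J : DIdx p k) :
    Real.log ‖g‖ + (dSum p k - differentOrd p (DFac p k J)) * Real.log p ≤
      packetLogμ p k (packetHull p k (⋃ γ : indTwo p k, γ • M)) := by
  have hM0 : ∃ x ∈ M, x ≠ 0 :=
    ⟨_, hgM (Set.smul_mem_smul_set (normalizedPacket p k).one_mem),
      by rw [smul_eq_mul, mul_one]; exact (map_ne_zero (iota p k i)).mpr hg0⟩
  obtain ⟨m, hm, -, -, hvol⟩ := exists_packetLogμ_packetHull_orbit_eq p k hMb hM0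
  have hc' := content_mul_log_le_sharp p k hc0 hc hg0 (hgM.trans hm) J
  have hH := sum_log_norm_le_packetLogμ_packetHull_logPacket p k hc0 hcΛ
  rw [hvol]
  linarith

/-- **SHARP LOWER END OF THE ORBIT-HULL VOLUME.** For a bounded region `M` of the packet containing the bare
region `ι_i(g)·(R_I)^∼` (`g ≠ 0`) and EVERY factor `L_J` of `V ≅ ∏_J L_J`:
**`log‖g‖ + (d_I − d_{L_J})·log p ≤ log μ̄(hull(⋃_{γ∈Ind2} γ·M))`** — w5-d082's `log‖g‖ + δ_Λ` lower end
(`packetLogμ_packetHull_orbit_ge_defect`) with the hull defect `δ_Λ` replaced by the packet's different against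
the factor's; against the Step (v) upper end `δ_Λ + {−λ_min + d_I + 1 + 4|I*|/p}·log p` the undecided band at a
summand is `{d_{L_J} + 1 + 4|I*|/p}·log p + δ_Λ`, no longer `{d_I + …}`. [cite: DupuyHilado2025, §4.9, §4.12]
[cite: Mochizuki2012, IUTchIV Prop. 1.1 p. 9] -/
theorem packetLogμ_packetHull_orbit_ge_sharp {M : Set (PacketAlgebra p k)} (hMb : IsPsiBounded p k M)
    {i : I} {g : k i} (hg0 : g ≠ 0)
    (hgM : iota p k i g • (normalizedPacket p k : Set (PacketAlgebra p k)) ⊆ M) (J : DIdx p k) :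
    Real.log ‖g‖ + (dSum p k - differentOrd p (DFac p k J)) * Real.log p ≤
      packetLogμ p k (packetHull p k (⋃ γ : indTwo p k, γ • M)) := by
  have hex := fun i' => exists_norm_le_norm_of_mem_logUnits p (k i')
  choose c hcΛ hc0 hc using hex
  exact packetLogμ_packetHull_orbit_ge_sharp_of_dominates p k hc0 hc hcΛ hMb hg0 hgM J

/-- **SHARP LOWER END, least factor different.** The same with `min_J d_{L_J}` (the factor field of least
different): `log‖g‖ + (d_I − min_J d_{L_J})·log p ≤ log μ̄(hull(⋃_{γ∈Ind2} γ·M))`.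
[cite: DupuyHilado2025, §4.9, §4.12] [cite: Mochizuki2012, IUTchIV Prop. 1.1 p. 9] -/
theorem packetLogμ_packetHull_orbit_ge_sharp_inf {M : Set (PacketAlgebra p k)} (hMb : IsPsiBounded p k M)
    {i : I} {g : k i} (hg0 : g ≠ 0)
    (hgM : iota p k i g • (normalizedPacket p k : Set (PacketAlgebra p k)) ⊆ M) :
    Real.log ‖g‖ + (dSum p k - (Finset.univ : Finset (DIdx p k)).inf' Finset.univ_nonempty
        (fun J => differentOrd p (DFac p k J))) * Real.log p ≤
      packetLogμ p k (packetHull p k (⋃ γ : indTwo p k, γ • M)) := by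
  obtain ⟨J, -, hJ⟩ := Finset.exists_mem_eq_inf' (Finset.univ_nonempty : (Finset.univ :
    Finset (DIdx p k)).Nonempty) (fun J => differentOrd p (DFac p k J))
  rw [hJ]
  exact packetLogμ_packetHull_orbit_ge_sharp p k hMb hg0 hgM J

end Packet

end Literature.IUT.LogVolume

end
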